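import Mathlib
import Summits.ValiantsHypothesis.ValiantsHypothesis.Theorems.KPlusLogSqLawStepZigzag

/-!
# The ZIGZAG LAW, odd first line (static path model behind `KPlusLogSqLaw.TropicalB`)

Cell pub-symmetroid, seat conjb-2 (g21). A helper toward the crux `TropicalB`
(`Summit.ValiantsHypothesis.ValiantsHypothesis.Theses.KPlusLogSqLaw.TropicalB`, item
`stmt-ValiantsHypothesis-19771`); it earns no crux credit and is not evidence for `MatrixDescartes` or for
Valiant's hypothesis.

The odd-first-line cases of the ZIGZAG LAW of `KPlusLogSqLawStepZigzag` (THEORY-NOTE-g21 §3.1quater), obtained from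
`zigzag_core` with the odd lines as the upper class of the negated lines (and `θ ↦ -θ` for the second direction
pattern): if rows `i` (odd) and `i+1` both step with odd reach `d` in opposite directions, the slope of the line
`i+d+1` lies strictly between those of the lines `i+1` and `i+d+2`.
-/

set_option linter.dupNamespace false

namespace Summit.ValiantsHypothesis.ValiantsHypothesis.Theorems.KPlusLogSqLawStepZigzagOdd

open Summit.ValiantsHypothesis.ValiantsHypothesis.Theorems.KPlusLogSqLawStepZigzag (zigzag_core)

/-- ZIGZAG LAW, odd first line, row `i` moving right and row `i+1` moving left (odd lines as the upper class of the negated lines). -/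
theorem zigzag_odd_rl (s b : ℕ → ℝ) (i d : ℕ) (hi : Odd i) (hd : Odd d)
    (hA : ∃ θ : ℝ, ∀ e o : ℕ, i ≤ e → e ≤ i + d → i ≤ o → o ≤ i + d → Even e → Odd o →
      b o + s o * θ < b e + s e * θ)
    (hB : ∃ θ : ℝ, ∀ e o : ℕ, i + 1 ≤ e → e ≤ i + d + 1 → i + 1 ≤ o → o ≤ i + d + 1 → Even e → Odd o →
      b o + s o * θ < b e + s e * θ)
    (hord : ∀ θ θ' : ℝ, (∀ e o : ℕ, i ≤ e → e ≤ i + d → i ≤ o → o ≤ i + d → Even e → Odd o →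
      b o + s o * θ < b e + s e * θ) → (∀ e o : ℕ, i + 1 ≤ e → e ≤ i + d + 1 → i + 1 ≤ o → o ≤ i + d + 1 →
      Even e → Odd o → b o + s o * θ' < b e + s e * θ') → θ < θ')
    (hB' : ∃ θ : ℝ, ∀ e o : ℕ, i + 2 ≤ e → e ≤ i + d + 2 → i + 2 ≤ o → o ≤ i + d + 2 → Even e → Odd o →
      b o + s o * θ < b e + s e * θ)
    (hBB' : ∀ θ : ℝ, ¬ ((∀ e o : ℕ, i + 1 ≤ e → e ≤ i + d + 1 → i + 1 ≤ o → o ≤ i + d + 1 → Even e →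
      Odd o → b o + s o * θ < b e + s e * θ) ∧ (∀ e o : ℕ, i + 2 ≤ e → e ≤ i + d + 2 → i + 2 ≤ o →
      o ≤ i + d + 2 → Even e → Odd o → b o + s o * θ < b e + s e * θ)))
    (hR : ∀ θ θ' : ℝ, (∀ e o : ℕ, i + 1 ≤ e → e ≤ i + d + 1 → i + 1 ≤ o → o ≤ i + d + 1 → Even e → Odd o →
      b o + s o * θ < b e + s e * θ) → (∀ e o : ℕ, i + 2 ≤ e → e ≤ i + d + 2 → i + 2 ≤ o → o ≤ i + d + 2 →
      Even e → Odd o → b o + s o * θ' < b e + s e * θ') → θ' < θ) :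
    s (i + d + 2) < s (i + d + 1) ∧ s (i + d + 1) < s (i + 1) := by
  have hlow1 : ¬ Odd (i + 1) := Nat.not_odd_iff_even.mpr (Odd.add_one hi)
  have hd1 : 1 ≤ d := by
    obtain ⟨l, hl⟩ := hd
    omega
  have hup1 : Odd (i + d + 1) := by
    obtain ⟨k, hk⟩ := hi
    obtain ⟨l, hl⟩ := hd
    exact ⟨k + l + 1, by omega⟩
  have hlow2 : ¬ Odd (i + d + 2) := by
    obtain ⟨k, hk⟩ := hi
    obtain ⟨l, hl⟩ := hd
    exact Nat.not_odd_iff_even.mpr ⟨k + l + 2, by omega⟩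
  obtain ⟨θA, hθA⟩ := hA
  obtain ⟨θB, hθB⟩ := hB
  obtain ⟨θB', hθB'⟩ := hB'
  have key := zigzag_core (fun n => Odd n) (fun t => - s t) (fun t => - b t) i d hlow1 hup1 hlow2 hd1
    ⟨θA, fun e o h1 h2 h3 h4 he ho => by
      have := hθA o e h3 h4 h1 h2 (Nat.not_odd_iff_even.mp ho) he
      linarith⟩
    ⟨θB, fun e o h1 h2 h3 h4 he ho => by
      have := hθB o e h3 h4 h1 h2 (Nat.not_odd_iff_even.mp ho) he
      linarith⟩
    (fun θ θ' hθ hθ' => hord θ θ'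
      (fun e o h1 h2 h3 h4 he ho => by
        have := hθ o e h3 h4 h1 h2 ho (Nat.not_odd_iff_even.mpr he)
        linarith)
      (fun e o h1 h2 h3 h4 he ho => by
        have := hθ' o e h3 h4 h1 h2 ho (Nat.not_odd_iff_even.mpr he)
        linarith))
    ⟨θB', fun e o h1 h2 h3 h4 he ho => by
      have := hθB' o e h3 h4 h1 h2 (Nat.not_odd_iff_even.mp ho) he
      linarith⟩
    (fun θ hθ => hBB' θ
      ⟨fun e o h1 h2 h3 h4 he ho => by
        have := hθ.1 o e h3 h4 h1 h2 ho (Nat.not_odd_iff_even.mpr he)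
        linarith,
       fun e o h1 h2 h3 h4 he ho => by
        have := hθ.2 o e h3 h4 h1 h2 ho (Nat.not_odd_iff_even.mpr he)
        linarith⟩)
    (fun θ θ' hθ hθ' => hR θ θ'
      (fun e o h1 h2 h3 h4 he ho => by
        have := hθ o e h3 h4 h1 h2 ho (Nat.not_odd_iff_even.mpr he)
        linarith)
      (fun e o h1 h2 h3 h4 he ho => by
        have := hθ' o e h3 h4 h1 h2 ho (Nat.not_odd_iff_even.mpr he)
        linarith))
  constructor <;> linarith [key.1, key.2]
/-- ZIGZAG LAW, odd first line, row `i` moving left and row `i+1` moving right (negated lines, `θ ↦ -θ`). -/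
theorem zigzag_odd_lr (s b : ℕ → ℝ) (i d : ℕ) (hi : Odd i) (hd : Odd d)
    (hA : ∃ θ : ℝ, ∀ e o : ℕ, i ≤ e → e ≤ i + d → i ≤ o → o ≤ i + d → Even e → Odd o →
      b o + s o * θ < b e + s e * θ)
    (hB : ∃ θ : ℝ, ∀ e o : ℕ, i + 1 ≤ e → e ≤ i + d + 1 → i + 1 ≤ o → o ≤ i + d + 1 → Even e → Odd o →
      b o + s o * θ < b e + s e * θ)
    (hord : ∀ θ θ' : ℝ, (∀ e o : ℕ, i ≤ e → e ≤ i + d → i ≤ o → o ≤ i + d → Even e → Odd o →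
      b o + s o * θ < b e + s e * θ) → (∀ e o : ℕ, i + 1 ≤ e → e ≤ i + d + 1 → i + 1 ≤ o → o ≤ i + d + 1 →
      Even e → Odd o → b o + s o * θ' < b e + s e * θ') → θ' < θ)
    (hB' : ∃ θ : ℝ, ∀ e o : ℕ, i + 2 ≤ e → e ≤ i + d + 2 → i + 2 ≤ o → o ≤ i + d + 2 → Even e → Odd o →
      b o + s o * θ < b e + s e * θ)
    (hBB' : ∀ θ : ℝ, ¬ ((∀ e o : ℕ, i + 1 ≤ e → e ≤ i + d + 1 → i + 1 ≤ o → o ≤ i + d + 1 → Even e →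
      Odd o → b o + s o * θ < b e + s e * θ) ∧ (∀ e o : ℕ, i + 2 ≤ e → e ≤ i + d + 2 → i + 2 ≤ o →
      o ≤ i + d + 2 → Even e → Odd o → b o + s o * θ < b e + s e * θ)))
    (hR : ∀ θ θ' : ℝ, (∀ e o : ℕ, i + 1 ≤ e → e ≤ i + d + 1 → i + 1 ≤ o → o ≤ i + d + 1 → Even e → Odd o →
      b o + s o * θ < b e + s e * θ) → (∀ e o : ℕ, i + 2 ≤ e → e ≤ i + d + 2 → i + 2 ≤ o → o ≤ i + d + 2 →
      Even e → Odd o → b o + s o * θ' < b e + s e * θ') → θ < θ') :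
    s (i + 1) < s (i + d + 1) ∧ s (i + d + 1) < s (i + d + 2) := by
  have hlow1 : ¬ Odd (i + 1) := Nat.not_odd_iff_even.mpr (Odd.add_one hi)
  have hd1 : 1 ≤ d := by
    obtain ⟨l, hl⟩ := hd
    omega
  have hup1 : Odd (i + d + 1) := by
    obtain ⟨k, hk⟩ := hi
    obtain ⟨l, hl⟩ := hd
    exact ⟨k + l + 1, by omega⟩
  have hlow2 : ¬ Odd (i + d + 2) := by
    obtain ⟨k, hk⟩ := hi
    obtain ⟨l, hl⟩ := hd
    exact Nat.not_odd_iff_even.mpr ⟨k + l + 2, by omega⟩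
  obtain ⟨θA, hθA⟩ := hA
  obtain ⟨θB, hθB⟩ := hB
  obtain ⟨θB', hθB'⟩ := hB'
  have key := zigzag_core (fun n => Odd n) s (fun t => - b t) i d hlow1 hup1 hlow2 hd1
    ⟨-θA, fun e o h1 h2 h3 h4 he ho => by
      have := hθA o e h3 h4 h1 h2 (Nat.not_odd_iff_even.mp ho) he
      have r1 : s o * -θA = -(s o * θA) := by ring
      have r2 : s e * -θA = -(s e * θA) := by ring
      linarith⟩
    ⟨-θB, fun e o h1 h2 h3 h4 he ho => by
      have := hθB o e h3 h4 h1 h2 (Nat.not_odd_iff_even.mp ho) he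
      have r1 : s o * -θB = -(s o * θB) := by ring
      have r2 : s e * -θB = -(s e * θB) := by ring
      linarith⟩
    (fun θ θ' hθ hθ' => by
      have := hord (-θ) (-θ')
        (fun e o h1 h2 h3 h4 he ho => by
          have := hθ o e h3 h4 h1 h2 ho (Nat.not_odd_iff_even.mpr he)
          have r1 : s o * -θ = -(s o * θ) := by ring
          have r2 : s e * -θ = -(s e * θ) := by ring
          linarith)
        (fun e o h1 h2 h3 h4 he ho => by
          have := hθ' o e h3 h4 h1 h2 ho (Nat.not_odd_iff_even.mpr he)
          have r1 : s o * -θ' = -(s o * θ') := by ring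
          have r2 : s e * -θ' = -(s e * θ') := by ring
          linarith)
      linarith)
    ⟨-θB', fun e o h1 h2 h3 h4 he ho => by
      have := hθB' o e h3 h4 h1 h2 (Nat.not_odd_iff_even.mp ho) he
      have r1 : s o * -θB' = -(s o * θB') := by ring
      have r2 : s e * -θB' = -(s e * θB') := by ring
      linarith⟩
    (fun θ hθ => hBB' (-θ)
      ⟨fun e o h1 h2 h3 h4 he ho => by
        have := hθ.1 o e h3 h4 h1 h2 ho (Nat.not_odd_iff_even.mpr he)
        have r1 : s o * -θ = -(s o * θ) := by ring
        have r2 : s e * -θ = -(s e * θ) := by ring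
        linarith,
       fun e o h1 h2 h3 h4 he ho => by
        have := hθ.2 o e h3 h4 h1 h2 ho (Nat.not_odd_iff_even.mpr he)
        have r1 : s o * -θ = -(s o * θ) := by ring
        have r2 : s e * -θ = -(s e * θ) := by ring
        linarith⟩)
    (fun θ θ' hθ hθ' => by
      have := hR (-θ) (-θ')
        (fun e o h1 h2 h3 h4 he ho => by
          have := hθ o e h3 h4 h1 h2 ho (Nat.not_odd_iff_even.mpr he)
          have r1 : s o * -θ = -(s o * θ) := by ring
          have r2 : s e * -θ = -(s e * θ) := by ring
          linarith)
        (fun e o h1 h2 h3 h4 he ho => by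
          have := hθ' o e h3 h4 h1 h2 ho (Nat.not_odd_iff_even.mpr he)
          have r1 : s o * -θ' = -(s o * θ') := by ring
          have r2 : s e * -θ' = -(s e * θ') := by ring
          linarith)
      linarith)
  exact key
end Summit.ValiantsHypothesis.ValiantsHypothesis.Theorems.KPlusLogSqLawStepZigzagOdd
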